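import Summits.ResolutionOfSingularities.ResolutionOfSingularities.Theorems.EquisingularLiftEquisingularLiftNatSpecimenSteinerPointStep
import Summits.ResolutionOfSingularities.ResolutionOfSingularities.Theorems.EquisingularLiftEquisingularLiftNatSpecimenConeVertexChart
import Summits.ResolutionOfSingularities.ResolutionOfSingularities.Theorems.EquisingularLiftEquisingularLiftNatVertexLineChartA
import Literature.AlgebraicGeometry.Resolution.VertexBlowupProjectionFibres
import Literature.AlgebraicGeometry.Resolution.CoordinateBlowupChart
import HarnessLib

/-!
# [OURS · L1 W4.5(b) · EL♮(3) · NOSE, N-2 (d) packet i] STEINER — THE STRICT TRANSFORM ON A VERTEX CHART: `𝓘⟨St⟩ · 𝒪 = (f₁⁽ⁱ⁾)~` on `Spec Cᵢ`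

res-L1-w45b-nose-w2 g2 (WIDTH seat on D-0157 DOOR 1; self-dealt under the desk's N-2 GO, STATUS l.≈83270). OURS; NOT a statement of any manuscript ([Hironaka2017]
is a candidate under adjudication, nothing of it is asserted); AI-written, weaker than expert review. No `sorry`; standard axioms; DEF-FREE (standing `local instance`
attribute of the specimen files). `--kind proof --supports stmt-ResolutionOfSingularities-20148 --as helper`; closes nothing. Resolution of singularities in positive
characteristic is NOT proved here or anywhere in this chain (dimension 3 is Cossart–Piltant 2008/2009 in print); EL♮(3) is NOT proved by this file.

WHAT. Packet data for clause (d) of «Steiner ∈ ν2» over the chart-atlas frame ✓ `isRegular_of_isBlowup_of_chartAtlas` (…NatBlowupRegularOfChartAtlas): for ANY blowing up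
`υ : F₂ ⟶ ℙ³` of the triple point `P = vertex 2 k` and the de Jong vertex chart `cᵢ = vertexChart hυ i : Spec Cᵢ ⟶ F₂` (`Cᵢ = k[y][𝔪/yᵢ] ≅ k[T₀,T₁,T₂]` by any
`θ` with `θ Tᵢ = yᵢ`, `θ T_j = y_j/yᵢ`), the strict transform `St = closure υ⁻¹(ι(S) ∖ {P})` of the Roman surface pulls back to the zero locus of the STRICT-TRANSFORM
POLYNOMIAL: §1 `algebraMap f = θ (coordBlowupSubst univ i f)` (Hu's substitution read in the chart) — for `i = 0`: `= yᵢ³ · θ f₁` (✓ `Steiner.subst_point_f`),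
`θ f₁` prime, `yᵢ ∉ (θ f₁)`; §2 `υ (cᵢ 𝔭) ∈ ι(S) ↔ algebraMap f ∈ 𝔭`, `υ (cᵢ 𝔭) = P ↔ yᵢ ∈ 𝔭`, hence `cᵢ⁻¹(υ⁻¹(ι(S) ∖ {P})) = {𝔭 | θ f₁ ∈ 𝔭, y₀ ∉ 𝔭}` (i = 0)
whose closure is `V(θ f₁)` (generic point); §3 ★ `comap_vertexChart_zero_vanishingIdeal_strict : 𝓘⟨St⟩.comap (vertexChart hυ 0) = (θ f₁)~` (the `hI`-type input of the
packet; `(θ f₁)` is radical). Packets `i = 1, 2` are the same text with the variables renamed; the chart of `St~` itself, `J = (ū, v̄)~` and the blow-up-algebra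
regularities (✓ p649392) complete the packet (generic Part B, next file).
-/

set_option linter.dupNamespace false -- mandated namespace `Summit.<Summit>.<Problem>` of this single-conjunct summit

noncomputable section

open CategoryTheory CategoryTheory.Limits AlgebraicGeometry TopologicalSpace HomogeneousLocalization
open MvPolynomial
open Literature.AlgebraicGeometry.Resolution Literature.AlgebraicGeometry.Resolution.DeJong1996
open Literature.AlgebraicGeometry.Motives Literature.AlgebraicGeometry.Motives.SmoothHypersurface
open Literature.AlgebraicGeometry.Motives.ProjectiveSpace
open AlgebraicGeometry.Scheme.IdealSheafData
open Summit.ResolutionOfSingularities.ResolutionOfSingularities.Theorems.EquisingularLift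

attribute [local instance] MvPolynomial.gradedAlgebra ProjBaseChange.algebraBase

namespace Summit.ResolutionOfSingularities.ResolutionOfSingularities.Cruxes.EquisingularLiftNat.Sections

namespace Steiner

variable (k : Type) [Field k]

/-! ## §1 Hu's substitution read in the vertex chart ring -/

/-- **The structure map `k[y] → Cᵢ` is Hu's substitution followed by the chart isomorphism**: `algebraMap G = θ (coordBlowupSubst univ i G)` for any
`k`-algebra isomorphism `θ : k[T] ≃ Cᵢ` with `θ Tᵢ = yᵢ`, `θ T_j = y_j/yᵢ` (`j ≠ i`) — both sides are `k`-algebra maps agreeing on the variables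
(`y_j ↦ yᵢ · (y_j/yᵢ)`, `yᵢ ↦ yᵢ`). [cite: Hu2025, §5 Prop. 5.3] (folklore) -/
theorem algebraMap_eq_algEquiv_coordBlowupSubst (i : Fin 3) (θ : MvPolynomial (Fin 3) k ≃ₐ[k] PointBlowup.Chart 2 k i)
    (hθi : θ (X i) = PointBlowup.exc 2 k i) (hθj : ∀ j : Fin 3, j ≠ i → θ (X j) = PointBlowup.frac 2 k i j) (G : MvPolynomial (Fin 3) k) :
    algebraMap (MvPolynomial (Fin 3) k) (PointBlowup.Chart 2 k i) G = θ (coordBlowupSubst k (Set.univ : Set (Fin 3)) i G) := by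
  have h := MvPolynomial.algHom_ext (A := PointBlowup.Chart 2 k i)
    (f := IsScalarTower.toAlgHom k (MvPolynomial (Fin 3) k) (PointBlowup.Chart 2 k i))
    (g := (θ : MvPolynomial (Fin 3) k →ₐ[k] PointBlowup.Chart 2 k i).comp (coordBlowupSubst k (Set.univ : Set (Fin 3)) i)) fun j => by
      rw [IsScalarTower.toAlgHom_apply, PointBlowup.algebraMap_X, AlgHom.comp_apply]
      by_cases hj : j = i
      · subst hj
        rw [coordBlowupSubst_X_self, AlgEquiv.coe_toAlgHom, hθi, PointBlowup.frac_self, mul_one]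
      · rw [coordBlowupSubst_X_of_mem_of_ne k _ _ (Set.mem_univ j) hj, map_mul, AlgEquiv.coe_toAlgHom, hθi, hθj j hj]
  exact congrArg (fun φ : MvPolynomial (Fin 3) k →ₐ[k] PointBlowup.Chart 2 k i => φ G) h

/-- **On the chart `y₀ ≠ 0`: `f = y₀³ · θ f₁`** (✓ `Steiner.subst_point_f`). [folklore] -/
theorem algebraMap_f_eq_exc_pow_mul (θ : MvPolynomial (Fin 3) k ≃ₐ[k] PointBlowup.Chart 2 k 0)
    (hθi : θ (X 0) = PointBlowup.exc 2 k 0) (hθj : ∀ j : Fin 3, j ≠ 0 → θ (X j) = PointBlowup.frac 2 k 0 j) :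
    algebraMap (MvPolynomial (Fin 3) k) (PointBlowup.Chart 2 k 0) (f k) = PointBlowup.exc 2 k 0 ^ 3 * θ (f₁ k) := by
  rw [algebraMap_eq_algEquiv_coordBlowupSubst k 0 θ hθi hθj, subst_point_f, map_mul, map_pow, hθi]

/-- `θ f₁` is prime (transport of ✓ `Steiner.prime_f₁`). [folklore] -/
theorem prime_algEquiv_f₁ (θ : MvPolynomial (Fin 3) k ≃ₐ[k] PointBlowup.Chart 2 k 0) : Prime (θ (f₁ k)) :=
  (MulEquiv.prime_iff θ.toMulEquiv).mpr (prime_f₁ k)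

/-- `y₀ ∉ (θ f₁)` (else `f₁ ∣ T₀`, so `f₁` would be associated to the irreducible `T₀`, contradicting `T₀ ∤ f₁`). [folklore] -/
theorem exc_notMem_span_algEquiv_f₁ (θ : MvPolynomial (Fin 3) k ≃ₐ[k] PointBlowup.Chart 2 k 0) (hθi : θ (X 0) = PointBlowup.exc 2 k 0) :
    PointBlowup.exc 2 k 0 ∉ Ideal.span {θ (f₁ k)} := by
  intro h
  rw [Ideal.mem_span_singleton, ← hθi] at h
  have hdvd : f₁ k ∣ X 0 := by
    obtain ⟨q, hq⟩ := h
    refine ⟨θ.symm q, θ.injective ?_⟩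
    rw [map_mul, AlgEquiv.apply_symm_apply]; exact hq
  have hXp : Prime (X 0 : MvPolynomial (Fin 3) k) := MvPolynomial.X_prime
  rcases hXp.irreducible.dvd_iff.mp hdvd with hu | hassoc
  · exact (prime_f₁ k).not_unit hu
  · exact X_zero_not_dvd_f₁ k hassoc.dvd

/-! ## §2 Where the vertex chart sends its points -/

section Chart

variable {k} {F₂ : Scheme.{0}} {υ : F₂ ⟶ SpecimenQuarticTcDelta.P3 k} (hυ : IsBlowup υ (vertexIdealSheaf 2 k))

/-- `toChart (F/x₃⁴ as a section) = algebraMap f` in `Cᵢ`. [folklore] -/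
theorem toChart_awayToSection_form (i : Fin 3) :
    DeJong1996.toChart 2 k i ((Proj.awayToSection (Segre.grading (Fin (2 + 1 + 1)) k) (X (Fin.last 3))).hom
        (Away.isLocalizationElem (Segre.X_mem k (Fin.last 3)) ((mem_homogeneousSubmodule 4 _).mpr (isHomogeneous_form k)))) =
      algebraMap (MvPolynomial (Fin 3) k) (PointBlowup.Chart 2 k i) (f k) := by
  rw [DeJong1996.toChart, RingHom.comp_apply, RingEquiv.toRingHom_eq_coe, RingEquiv.coe_toRingHom, lastChartEquiv_awayToSection]
  refine congrArg _ ?_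
  rw [isLocalizationElem_X]
  exact ((ProjectiveSpace.chartAlgEquiv k (Fin.last 3)).apply_symm_apply _).trans (dehomogenize_form_three k)

include hυ in
/-- **`υ (cᵢ 𝔭) ∈ ι(S) ↔ f ∈ 𝔭`** (read through `toChart`). [folklore] -/
theorem vertexChart_apply_mem_range_iff (i : Fin 3) (𝔭 : Spec (.of (PointBlowup.Chart 2 k i))) :
    υ (vertexChart hυ i 𝔭) ∈ Set.range (hypersurfaceι (form k)).left ↔
      algebraMap (MvPolynomial (Fin 3) k) (PointBlowup.Chart 2 k i) (f k) ∈ 𝔭.asIdeal := by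
  rw [vertexChart_comp_apply hυ i 𝔭]
  have h := Set.ext_iff.mp (ProjSubscheme.awayι_preimage_zeroLocus (Segre.grading (Fin (2 + 1 + 1)) k) (Segre.X_mem k (Fin.last 3)) zero_lt_one
    ((mem_homogeneousSubmodule 4 _).mpr (isHomogeneous_form k)) (by norm_num))
    (Spec.map (Proj.awayToSection (Segre.grading (Fin (2 + 1 + 1)) k) (X (Fin.last 3))) (Spec.map (CommRingCat.ofHom (toChart 2 k i)) 𝔭))
  rw [Set.mem_preimage] at h
  erw [range_hypersurfaceι]
  refine h.trans ((SpecimenQuarticTcDelta.mem_zeroLocus_singleton_iff' _ _).trans ?_)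
  rw [← toChart_awayToSection_form]
  rfl

include hυ in
/-- **`υ (cᵢ 𝔭) = P ↔ yᵢ ∈ 𝔭`** (the exceptional divisor of the chart is `V(yᵢ)`). [folklore] -/
theorem vertexChart_apply_eq_vertex_iff (i : Fin 3) (𝔭 : Spec (.of (PointBlowup.Chart 2 k i))) :
    υ (vertexChart hυ i 𝔭) = vertex 2 k ↔ PointBlowup.exc 2 k i ∈ 𝔭.asIdeal := by
  refine ⟨exc_mem_of_apply_vertexChart_eq υ hυ i 𝔭, fun hexc => ?_⟩
  rw [vertexChart_comp_apply hυ i 𝔭, eq_vertex_iff]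
  simp only [X_castSucc_mem_awayι_iff, chartGen_mem_iff i 𝔭]
  intro j
  rw [PointBlowup.algebraMap_X]
  exact Ideal.mul_mem_right _ _ hexc

include hυ in
/-- **The punctured strict transform on the chart `y₀ ≠ 0`**: `c₀ 𝔭 ∈ υ⁻¹(ι(S) ∖ {P}) ↔ θ f₁ ∈ 𝔭 ∧ y₀ ∉ 𝔭`. [folklore] -/
theorem vertexChart_zero_apply_mem_iff (θ : MvPolynomial (Fin 3) k ≃ₐ[k] PointBlowup.Chart 2 k 0)
    (hθi : θ (X 0) = PointBlowup.exc 2 k 0) (hθj : ∀ j : Fin 3, j ≠ 0 → θ (X j) = PointBlowup.frac 2 k 0 j)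
    (𝔭 : Spec (.of (PointBlowup.Chart 2 k 0))) :
    vertexChart hυ 0 𝔭 ∈ υ ⁻¹' (Set.range (hypersurfaceι (form k)).left \ {vertex 2 k}) ↔
      θ (f₁ k) ∈ 𝔭.asIdeal ∧ PointBlowup.exc 2 k 0 ∉ 𝔭.asIdeal := by
  have h1 := vertexChart_apply_mem_range_iff hυ 0 𝔭
  have h2 := vertexChart_apply_eq_vertex_iff hυ 0 𝔭
  rw [algebraMap_f_eq_exc_pow_mul k θ hθi hθj] at h1
  change (υ (vertexChart hυ 0 𝔭) ∈ Set.range (hypersurfaceι (form k)).left ∧ ¬ υ (vertexChart hυ 0 𝔭) = vertex 2 k) ↔ _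
  refine (h1.and h2.not).trans ?_
  constructor
  · rintro ⟨hmem, hexc⟩
    exact ⟨((𝔭.2.mem_or_mem hmem).resolve_left fun h => hexc (𝔭.2.mem_of_pow_mem 3 h)), hexc⟩
  · rintro ⟨hmem, hexc⟩
    exact ⟨Ideal.mul_mem_left _ _ hmem, hexc⟩

include hυ in
/-- **`c₀⁻¹ St = V(θ f₁)`**: the strict transform meets the chart `Spec C₀` in the zero locus of the strict-transform polynomial (closure of the punctured
locus = closure of the generic point `(θ f₁)`, which lies off `V(y₀)`). [cite: Hartshorne1977, II §7 (strict transform)] (OURS computation; folklore) -/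
theorem preimage_vertexChart_zero_strict (θ : MvPolynomial (Fin 3) k ≃ₐ[k] PointBlowup.Chart 2 k 0)
    (hθi : θ (X 0) = PointBlowup.exc 2 k 0) (hθj : ∀ j : Fin 3, j ≠ 0 → θ (X j) = PointBlowup.frac 2 k 0 j) :
    (vertexChart hυ 0) ⁻¹' closure (υ ⁻¹' (Set.range (hypersurfaceι (form k)).left \ {vertex 2 k})) =
      PrimeSpectrum.zeroLocus {θ (f₁ k)} := by
  rw [(vertexChart hυ 0).isOpenEmbedding.isOpenMap.preimage_closure_eq_closure_preimage (vertexChart hυ 0).continuous]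
  have hset : (vertexChart hυ 0) ⁻¹' (υ ⁻¹' (Set.range (hypersurfaceι (form k)).left \ {vertex 2 k})) =
      {𝔭 : PrimeSpectrum (PointBlowup.Chart 2 k 0) | θ (f₁ k) ∈ 𝔭.asIdeal ∧ PointBlowup.exc 2 k 0 ∉ 𝔭.asIdeal} := by
    ext 𝔭; exact vertexChart_zero_apply_mem_iff hυ θ hθi hθj 𝔭
  rw [hset]
  apply le_antisymm
  · refine closure_minimal (fun 𝔭 h𝔭 => ?_) (PrimeSpectrum.isClosed_zeroLocus _)
    exact (SpecimenQuarticTcDelta.mem_zeroLocus_singleton_iff' 𝔭 _).mpr h𝔭.1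
  · let q : PrimeSpectrum (PointBlowup.Chart 2 k 0) :=
      ⟨Ideal.span {θ (f₁ k)}, (Ideal.span_singleton_prime (prime_algEquiv_f₁ k θ).ne_zero).mpr (prime_algEquiv_f₁ k θ)⟩
    have hq : q ∈ {𝔭 : PrimeSpectrum (PointBlowup.Chart 2 k 0) | θ (f₁ k) ∈ 𝔭.asIdeal ∧ PointBlowup.exc 2 k 0 ∉ 𝔭.asIdeal} :=
      ⟨Ideal.subset_span rfl, exc_notMem_span_algEquiv_f₁ k θ hθi⟩
    calc PrimeSpectrum.zeroLocus {θ (f₁ k)}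
        = closure {q} := by
          rw [← PrimeSpectrum.zeroLocus_span {θ (f₁ k)}]; exact (PrimeSpectrum.closure_singleton q).symm
      _ ≤ _ := closure_mono (Set.singleton_subset_iff.mpr hq)

/-! ## §3 The ideal of the strict transform on the chart -/

include hυ in
/-- ★ **`𝓘⟨St⟩ · 𝒪_{Spec C₀} = (θ f₁)~`** — the reduced strict transform of the Roman surface is cut out on the vertex chart `y₀ ≠ 0` by the strict-transform
polynomial `f₁ = y₀(u² + u²v² + v²) + uv` (read through `θ`), a prime. This is the chart-side input of packet `i = 0` of clause (d). [OURS · L1 W4.5b · (d) packet 0] -/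
theorem comap_vertexChart_zero_vanishingIdeal_strict (θ : MvPolynomial (Fin 3) k ≃ₐ[k] PointBlowup.Chart 2 k 0)
    (hθi : θ (X 0) = PointBlowup.exc 2 k 0) (hθj : ∀ j : Fin 3, j ≠ 0 → θ (X j) = PointBlowup.frac 2 k 0 j) :
    (vanishingIdeal (⟨closure (υ ⁻¹' (Set.range (hypersurfaceι (form k)).left \ {vertex 2 k})), isClosed_closure⟩ : Closeds F₂)).comap
        (vertexChart hυ 0) =
      ofIdealTop ((Ideal.span {θ (f₁ k)}).map (Scheme.ΓSpecIso (CommRingCat.of (PointBlowup.Chart 2 k 0))).inv.hom) := by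
  rw [comap_vanishingIdeal_of_isOpenImmersion]
  have h : (Closeds.preimage (⟨closure (υ ⁻¹' (Set.range (hypersurfaceι (form k)).left \ {vertex 2 k})), isClosed_closure⟩ : Closeds F₂)
      (vertexChart hυ 0).continuous) = ⟨PrimeSpectrum.zeroLocus {θ (f₁ k)}, PrimeSpectrum.isClosed_zeroLocus _⟩ :=
    Closeds.ext (preimage_vertexChart_zero_strict hυ θ hθi hθj)
  rw [h, SpecimenQuarticTcDelta.vanishingIdeal_zeroLocus_Spec,
    ((Ideal.span_singleton_prime (prime_algEquiv_f₁ k θ).ne_zero).mpr (prime_algEquiv_f₁ k θ)).radical]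

end Chart

end Steiner

end Summit.ResolutionOfSingularities.ResolutionOfSingularities.Cruxes.EquisingularLiftNat.Sections

end
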